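import Summits.Ventures.CertifiedArithmetic.Expansions.CompressStaircaseFixedPoint
import Mathlib.Tactic.Linarith
import Mathlib.Tactic.NormNum

/-!
# COMPRESS is local across inert junctions (new work)

New work of the certified-arithmetic venture (ENGINES group: shared numerical engines serving
client cells; rigour lives in the verifiers; every published number belongs to a client cell's
ledger, not to the engines group).  Setting of the tree's `Shewchuk1997.Compress` (Shewchuk's
COMPRESS [Shewchuk1997, §2.7 p. 332], expansions listed smallest component first, an arbitrary
rounding `fl` with `fl 0 = 0` — no rounding model is needed here).  NOT a published theorem:
Shewchuk proves Theorem 23 only; these identities organise the study of iterated COMPRESS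
(`CompressNotIdempotent*.lean`, `CompressThreePasses.lean`).

Call a pair `a` (smaller), `b` (larger) INERT when `fl(b + a) = b`, `fl a = a` and `a ≠ 0` — the
relation of the replay lemma `compress_eq_self_of_isChain` (`CompressStaircaseFixedPoint.lean`):
FAST-TWO-SUM(b, a) then returns `(b, a)` (`fastTwoSum_eq_of_absorb`), so both traversals of COMPRESS
pass the pair through unchanged.  A CHAIN is a list whose consecutive pairs are inert.

* `compressDown_append` — the downward sweep (Lines 1–9) distributes over concatenation;
  `compressUp_append` — the upward sweep (Lines 10–16) over `gs ++ rest` is the sweep over `gs` with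
  its last output (the running carry) handed on to `rest` (generalises `compressUp_append_singleton`
  of `CompressFixedPointChain.lean` from one extra component to any list).
* `compressDown_append_of_isChain`, `compressUp_append_of_isChain` — along a chain both sweeps
  emit every component and hand the chain's far end on as the carry.
* **Locality** (`compress_append_of_isChain_left`, `compress_append_of_isChain_right`,
  `compress_append3_of_isChain`): if `low` is a chain that stays inert against the bottom carry `q`
  of `mid`'s downward sweep (`low ++ [q]` a chain), then `COMPRESS(low ++ mid) = low ++ COMPRESS(mid)`;
  if `high` is a chain inert against both the top component `M` of `mid` and the top component `T`
  of `COMPRESS(mid)` (`M :: high` and `T :: high` chains), then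
  `COMPRESS(mid ++ high) = COMPRESS(mid) ++ high`; hence
  `COMPRESS(low ++ mid ++ high) = low ++ COMPRESS(mid) ++ high`.  So a pass of COMPRESS acts only on
  the ACTIVE window `mid`; this is the bookkeeping behind families of inputs on which every pass
  moves a short active window one block down (pass counts growing linearly with the length).
-/

namespace Summit.Ventures.CertifiedArithmetic.Expansions

open Literature.ComputerArithmetic.Shewchuk1997

variable {fl : ℚ → ℚ}

/-- An inert pair passes FAST-TWO-SUM unchanged: `fl(a + b) = a`, `fl b = b`, `fl 0 = 0` give
FAST-TWO-SUM(a, b) `= (a, b)`. [cite: Shewchuk1997, §2.3 Theorem 6 (FAST-TWO-SUM)] -/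
theorem fastTwoSum_eq_of_absorb (h0 : fl 0 = 0) {a b : ℚ} (hb : fl b = b) (h : fl (a + b) = a) :
    fastTwoSum fl a b = (a, b) := by
  simp [fastTwoSum, h, h0, hb]

/-! ### The two sweeps over concatenations -/

/-- The downward sweep distributes over concatenation: sweep `xs`, then sweep `ys` from the
resulting carry. [cite: Shewchuk1997, §2.7 p. 332 (COMPRESS), Lines 1–9] -/
theorem compressDown_append (fl : ℚ → ℚ) : ∀ (xs ys : List ℚ) (Q : ℚ),
    compressDown fl Q (xs ++ ys) =
      ((compressDown fl Q xs).1 ++ (compressDown fl (compressDown fl Q xs).2 ys).1,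
        (compressDown fl (compressDown fl Q xs).2 ys).2)
  | [], ys, Q => by simp
  | x :: xs, ys, Q => by
    rw [List.cons_append]
    by_cases h : (fastTwoSum fl Q x).2 = 0
    · rw [compressDown_cons_of_eq_zero h, compressDown_cons_of_eq_zero h]
      exact compressDown_append fl xs ys _
    · rw [compressDown_cons_of_ne_zero h, compressDown_cons_of_ne_zero h]
      dsimp only
      rw [compressDown_append fl xs ys _, List.cons_append]

/-- The upward sweep over `gs ++ rest`: the sweep over `gs` emits `ys` and ends with the carry `T`
(its last output); the sweep then continues over `rest` from `T`.
[cite: Shewchuk1997, §2.7 p. 332 (COMPRESS), Lines 10–16] -/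
theorem compressUp_append (fl : ℚ → ℚ) : ∀ (gs : List ℚ) (Q : ℚ) (rest : List ℚ),
    ∃ ys : List ℚ, ∃ T : ℚ, compressUp fl Q gs = ys ++ [T] ∧
      compressUp fl Q (gs ++ rest) = ys ++ compressUp fl T rest
  | [], Q, rest => ⟨[], Q, by simp, by simp⟩
  | g :: gs, Q, rest => by
    obtain ⟨ys, T, h1, h2⟩ := compressUp_append fl gs (fastTwoSum fl g Q).1 rest
    by_cases h : (fastTwoSum fl g Q).2 = 0
    · exact ⟨ys, T, by rw [compressUp_cons_of_eq_zero h, h1],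
        by rw [List.cons_append, compressUp_cons_of_eq_zero h, h2]⟩
    · exact ⟨(fastTwoSum fl g Q).2 :: ys, T, by rw [compressUp_cons_of_ne_zero h, h1, List.cons_append],
        by rw [List.cons_append, compressUp_cons_of_ne_zero h, h2, List.cons_append]⟩

/-- Downward sweep ALONG A CHAIN (largest first: each `a` above `b` with `fl(a + b) = a`, `fl b = b`,
`b ≠ 0`): every component of the chain is emitted and its far end `b` is handed on as the carry.
[cite: Shewchuk1997, §2.7 p. 332 (COMPRESS), Lines 1–9] -/
theorem compressDown_append_of_isChain (h0 : fl 0 = 0) :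
    ∀ (ds : List ℚ) (Q b : ℚ) (rest : List ℚ),
      List.IsChain (fun a b => fl (a + b) = a ∧ fl b = b ∧ b ≠ 0) (Q :: (ds ++ [b])) →
        compressDown fl Q (ds ++ b :: rest) =
          (Q :: ds ++ (compressDown fl b rest).1, (compressDown fl b rest).2)
  | [], Q, b, rest, h => by
    obtain ⟨hQb, hb, hb0⟩ : fl (Q + b) = Q ∧ fl b = b ∧ b ≠ 0 := by simpa using h
    have hfts : fastTwoSum fl Q b = (Q, b) := fastTwoSum_eq_of_absorb h0 hb hQb
    rw [List.nil_append, compressDown_cons_of_ne_zero (by rw [hfts]; exact hb0), hfts]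
    simp
  | d :: ds, Q, b, rest, h => by
    rw [List.cons_append] at h
    obtain ⟨⟨hQd, hd, hd0⟩, hrest⟩ := List.isChain_cons_cons.mp h
    have hfts : fastTwoSum fl Q d = (Q, d) := fastTwoSum_eq_of_absorb h0 hd hQd
    rw [List.cons_append, compressDown_cons_of_ne_zero (by rw [hfts]; exact hd0), hfts]
    dsimp only
    rw [compressDown_append_of_isChain h0 ds d b rest hrest]
    simp

/-- Upward sweep ALONG A CHAIN (smallest first: each `a` below `b` with `fl(b + a) = b`, `fl a = a`,
`a ≠ 0`): every component is emitted and the chain's top `T` is handed on as the carry.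
[cite: Shewchuk1997, §2.7 p. 332 (COMPRESS), Lines 10–16] -/
theorem compressUp_append_of_isChain (h0 : fl 0 = 0) :
    ∀ (gs : List ℚ) (Q T : ℚ) (rest : List ℚ),
      List.IsChain (fun a b => fl (b + a) = b ∧ fl a = a ∧ a ≠ 0) (Q :: (gs ++ [T])) →
        compressUp fl Q (gs ++ T :: rest) = Q :: (gs ++ compressUp fl T rest)
  | [], Q, T, rest, h => by
    obtain ⟨hTQ, hQ, hQ0⟩ : fl (T + Q) = T ∧ fl Q = Q ∧ Q ≠ 0 := by simpa using h
    have hfts : fastTwoSum fl T Q = (T, Q) := fastTwoSum_eq_of_absorb h0 hQ hTQ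
    rw [List.nil_append, compressUp_cons_of_ne_zero (by rw [hfts]; exact hQ0), hfts]
    simp
  | g :: gs, Q, T, rest, h => by
    rw [List.cons_append] at h
    obtain ⟨⟨hgQ, hQ, hQ0⟩, hrest⟩ := List.isChain_cons_cons.mp h
    have hfts : fastTwoSum fl g Q = (g, Q) := fastTwoSum_eq_of_absorb h0 hQ hgQ
    rw [List.cons_append, compressUp_cons_of_ne_zero (by rw [hfts]; exact hQ0), hfts]
    dsimp only
    rw [compressUp_append_of_isChain h0 gs g T rest hrest, List.cons_append]

/-! ### Locality -/

/-- **Locality below.**  Let `mid = midrest ++ [M]` (smallest first) and let `q` be the bottom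
carry of `mid`'s downward sweep.  If `low ++ [q]` is a chain (each smaller component absorbed by
the next, rounded to itself, nonzero), then `COMPRESS(low ++ mid) = low ++ COMPRESS(mid)`: the
downward sweep emits `q` on meeting the top of `low` and walks down the chain; the upward sweep
re-emits `low` and resumes `mid`'s upward sweep from `q`. [cite: Shewchuk1997, §2.7 p. 332 (COMPRESS)] -/
theorem compress_append_of_isChain_left (h0 : fl 0 = 0) {low midrest : List ℚ} {M : ℚ}
    (hlow : List.IsChain (fun a b => fl (b + a) = b ∧ fl a = a ∧ a ≠ 0)
      (low ++ [(compressDown fl M midrest.reverse).2])) :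
    compress fl (low ++ (midrest ++ [M])) = low ++ compress fl (midrest ++ [M]) := by
  cases low with
  | nil => simp
  | cons l0 lmid =>
    have hmid : compress fl (midrest ++ [M]) =
        compressUp fl (compressDown fl M midrest.reverse).2
          (compressDown fl M midrest.reverse).1.reverse := by
      simp [compress, List.reverse_append]
    have hrev : (l0 :: lmid ++ (midrest ++ [M])).reverse =
        M :: (midrest.reverse ++ (lmid.reverse ++ [l0])) := by simp
    have hall : compress fl (l0 :: lmid ++ (midrest ++ [M])) =
        compressUp fl (compressDown fl M (midrest.reverse ++ (lmid.reverse ++ [l0]))).2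
          (compressDown fl M (midrest.reverse ++ (lmid.reverse ++ [l0]))).1.reverse := by
      simp only [compress, hrev]
    rw [hall, hmid, compressDown_append]
    generalize hq : (compressDown fl M midrest.reverse).2 = q at *
    generalize hG : (compressDown fl M midrest.reverse).1 = G at *
    -- the chain `low ++ [q]`, largest first, is `q :: lmid.reverse ++ [l0]`
    have hdown : List.IsChain (fun a b => fl (a + b) = a ∧ fl b = b ∧ b ≠ 0)
        (q :: (lmid.reverse ++ [l0])) := by
      have := List.isChain_reverse.mpr hlow
      simpa [List.reverse_append] using this
    rw [compressDown_append_of_isChain h0 lmid.reverse q l0 [] hdown]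
    simp only [compressDown_nil, List.append_nil, List.reverse_append, List.reverse_cons,
      List.reverse_reverse, List.cons_append]
    -- upward: `l0 :: lmid ++ q :: G.reverse`, along the chain `low ++ [q]`
    have hup := compressUp_append_of_isChain h0 lmid l0 q G.reverse
      (by simpa [List.cons_append] using hlow)
    simpa [List.append_assoc] using hup

/-- **Locality above.**  Let `mid = midrest ++ [M]` (smallest first), `COMPRESS(mid) = ys ++ [T]`.
If `high` is a chain inert against `M` and against `T` (`M :: high` and `T :: high` chains), then
`COMPRESS(mid ++ high) = COMPRESS(mid) ++ high`: the downward sweep walks down `high`, emits its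
bottom on meeting `M` and runs `mid`'s sweep; the upward sweep finishes `mid`'s sweep with carry
`T`, emits `T` on meeting `high` and re-emits `high`. [cite: Shewchuk1997, §2.7 p. 332 (COMPRESS)] -/
theorem compress_append_of_isChain_right (h0 : fl 0 = 0) {midrest : List ℚ} {M : ℚ}
    {high ys : List ℚ} {T : ℚ} (hys : compress fl (midrest ++ [M]) = ys ++ [T])
    (hM : List.IsChain (fun a b => fl (b + a) = b ∧ fl a = a ∧ a ≠ 0) (M :: high))
    (hT : List.IsChain (fun a b => fl (b + a) = b ∧ fl a = a ∧ a ≠ 0) (T :: high)) :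
    compress fl ((midrest ++ [M]) ++ high) = compress fl (midrest ++ [M]) ++ high := by
  -- split off the top of `high`
  rcases List.eq_nil_or_concat high with rfl | ⟨hinit, htop, rfl⟩
  · simp
  rw [List.concat_eq_append] at hM hT ⊢
  have hmid : compress fl (midrest ++ [M]) =
      compressUp fl (compressDown fl M midrest.reverse).2
        (compressDown fl M midrest.reverse).1.reverse := by
    simp [compress, List.reverse_append]
  have hrev : ((midrest ++ [M]) ++ (hinit ++ [htop])).reverse =
      htop :: (hinit.reverse ++ (M :: midrest.reverse)) := by simp
  have hall : compress fl ((midrest ++ [M]) ++ (hinit ++ [htop])) =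
      compressUp fl (compressDown fl htop (hinit.reverse ++ (M :: midrest.reverse))).2
        (compressDown fl htop (hinit.reverse ++ (M :: midrest.reverse))).1.reverse := by
    simp only [compress, hrev]
  -- downward: along the chain `M :: high` (largest first `htop :: hinit.reverse ++ [M]`)
  have hdown : List.IsChain (fun a b => fl (a + b) = a ∧ fl b = b ∧ b ≠ 0)
      (htop :: (hinit.reverse ++ [M])) := by
    have := List.isChain_reverse.mpr hM
    simpa [List.reverse_append] using this
  rw [hall, compressDown_append_of_isChain h0 hinit.reverse htop M midrest.reverse hdown]
  simp only [List.reverse_append, List.reverse_cons, List.reverse_reverse, List.cons_append,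
    List.append_assoc]
  -- upward: finish `mid`'s sweep, then along the chain `T :: high`
  obtain ⟨ys', T', h1, h2⟩ := compressUp_append fl (compressDown fl M midrest.reverse).1.reverse
    (compressDown fl M midrest.reverse).2 (hinit ++ [htop])
  have hT' : ys' = ys ∧ T' = T := by
    have h := (h1.symm.trans (hmid.symm.trans hys))
    obtain ⟨h3, h4⟩ := List.append_inj' h rfl
    exact ⟨h3, by simpa using h4⟩
  obtain ⟨rfl, rfl⟩ := hT'
  rw [h2, hys]
  rcases hinit with _ | ⟨h1', hs⟩
  · -- `high = [htop]`
    obtain ⟨hTt, hTT, hT0⟩ : fl (htop + T') = htop ∧ fl T' = T' ∧ T' ≠ 0 := by simpa using hT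
    have hfts : fastTwoSum fl htop T' = (htop, T') := fastTwoSum_eq_of_absorb h0 hTT hTt
    rw [List.nil_append, compressUp_cons_of_ne_zero (by rw [hfts]; exact hT0), hfts]
    simp
  · have hup := compressUp_append_of_isChain h0 (h1' :: hs) T' htop [] (by simpa using hT)
    rw [hup]
    simp

/-- **Locality on both sides**: with `low ++ [q]` a chain (`q` the bottom carry of `mid`'s downward
sweep) and `M :: high`, `T :: high` chains (`M` the top of `mid`, `T` the top of `COMPRESS(mid)`),
`COMPRESS(low ++ mid ++ high) = low ++ COMPRESS(mid) ++ high` — one pass of COMPRESS acts on the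
active window `mid` only. [cite: Shewchuk1997, §2.7 p. 332 (COMPRESS)] -/
theorem compress_append3_of_isChain (h0 : fl 0 = 0) {low midrest : List ℚ} {M : ℚ}
    {high ys : List ℚ} {T : ℚ}
    (hlow : List.IsChain (fun a b => fl (b + a) = b ∧ fl a = a ∧ a ≠ 0)
      (low ++ [(compressDown fl M midrest.reverse).2]))
    (hys : compress fl (midrest ++ [M]) = ys ++ [T])
    (hM : List.IsChain (fun a b => fl (b + a) = b ∧ fl a = a ∧ a ≠ 0) (M :: high))
    (hT : List.IsChain (fun a b => fl (b + a) = b ∧ fl a = a ∧ a ≠ 0) (T :: high)) :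
    compress fl (low ++ (midrest ++ [M]) ++ high) = low ++ compress fl (midrest ++ [M]) ++ high := by
  have hleft := compress_append_of_isChain_left h0 hlow
  -- `low ++ mid` has the same top `M`, the same downward sweep below it, and
  -- `COMPRESS(low ++ mid) = (low ++ ys) ++ [T]`
  have hleft' : compress fl ((low ++ midrest) ++ [M]) = (low ++ ys) ++ [T] := by
    simp only [List.append_assoc, hleft, hys]
  have := compress_append_of_isChain_right h0 (midrest := low ++ midrest) hleft' hM hT
  simpa [List.append_assoc, hleft] using this

end Summit.Ventures.CertifiedArithmetic.Expansions
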